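import Summits.PneNP.PneNP.Theorems.ConvexRankGatesConvexGateBlindExactLiftingTrianglePlaneLocalAdd

/-!
# Triangle instance — plane-local factorisations: additive atoms are exactly useless

Support file for crux `ConvexGateBlind` (stmt-PneNP-10680), open stub `stub_exactLifting` (prover seat 3, session 15);
sequel of `…TrianglePlaneLocalAdd` (`AddSolves H` ⇔ the dictionary `H` solves the per-plane problem at some room `ε > 0`).

* `addSolves_of_core`: the sign pattern of `(α, β)` in `AddSolves` is automatic — it follows from the additive difference,
  the two strict inequality families and non-negativity (so a search or a proof only has to produce the core data).
* `addSolves_remove_additive` (registered form `triangle_planeLocal_lines`): if a dictionary made of `H` together with ANY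
  family `G` of non-negative ADDITIVE matrices `f_k ⊕ g_k` (`f_k, g_k ≥ 0`; e.g. the in-plane lines, or any `b`-independent
  gradient one might add per plane) satisfies `AddSolves`, then `H` alone does: drop the additive atoms, keep the coefficients on
  `H`, and correct `(α, β)` by the additive atoms' own row/column parts.  So for the ε-UNIFORM question in the plane-local model
  the lines contribute nothing: `m_+(t) = min {|H| : AddSolves H}` may be computed over line-free dictionaries, and every lower
  bound may assume no atom is additive (memo `PLANELOCAL-seat3.md` §2).

Nothing here is cited; everything is elementary.
-/

set_option linter.dupNamespace false -- `Summit.PneNP.PneNP.…`: summit = sub-problem (D-0017)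

namespace Summit.PneNP.PneNP.Theorems.XorDoor.TriLine

open Finset

noncomputable section

variable {t : ℕ}

/-- **The signs are automatic.**  Core additive-coupling data at a non-degenerate pair — non-negative coefficients, an additive
difference `X₀ − X₁ = α ⊕ β` for SOME real `α, β`, and the two strict inequality families — already has the block sign
pattern: `α a > X₀(a,d') ≥ 0` on `P`, `β d' ≤ X₀(a,d') − α a < 0` off `S` (from `X₁ ≥ 0`), and symmetrically. -/
theorem addSolves_of_core {ι : Type} [Fintype ι] {H : ι → Fin t → Fin t → ℝ} (hH : ∀ i a d, 0 ≤ H i a d)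
    (h : ∀ P S : Fin t → Bool, (∃ a, P a = true) → (∃ a, P a = false) → (∃ d, S d = true) → (∃ d, S d = false) →
      ∃ (c₀ c₁ : ι → ℝ) (α β : Fin t → ℝ), (∀ i, 0 ≤ c₀ i) ∧ (∀ i, 0 ≤ c₁ i) ∧
        (∀ a d, ∑ i, c₀ i * H i a d - ∑ i, c₁ i * H i a d = α a + β d) ∧
        (∀ a d, P a = true → S d = false → ∑ i, c₀ i * H i a d < α a) ∧
        (∀ a d, P a = false → S d = true → ∑ i, c₀ i * H i a d < β d)) :
    AddSolves H := by
  intro P S hP1 hP0 hS1 hS0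
  obtain ⟨c₀, c₁, α, β, hc₀, hc₁, hadd, hB, hC⟩ := h P S hP1 hP0 hS1 hS0
  obtain ⟨a₁, ha₁⟩ := hP1
  obtain ⟨a₀, ha₀⟩ := hP0
  obtain ⟨d₁, hd₁⟩ := hS1
  obtain ⟨d₀, hd₀⟩ := hS0
  have hX0 : ∀ a d, 0 ≤ ∑ i, c₀ i * H i a d := fun a d =>
    Finset.sum_nonneg fun i _ => mul_nonneg (hc₀ i) (hH i a d)
  have hX1 : ∀ a d, 0 ≤ ∑ i, c₁ i * H i a d := fun a d =>
    Finset.sum_nonneg fun i _ => mul_nonneg (hc₁ i) (hH i a d)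
  refine ⟨c₀, c₁, α, β, hc₀, hc₁, hadd, ?_, ?_, ?_, ?_, hB, hC⟩
  · intro a ha
    have := hB a d₀ ha hd₀; have := hX0 a d₀; linarith
  · intro a ha
    have e := hadd a d₁
    have := hC a d₁ ha hd₁; have := hX1 a d₁; linarith
  · intro d hd
    have := hC a₀ d ha₀ hd; have := hX0 a₀ d; linarith
  · intro d hd
    have e := hadd a₁ d
    have := hB a₁ d ha₁ hd; have := hX1 a₁ d; linarith

/-- **Additive atoms are removable.**  If `H` together with a family `G` of non-negative additive matrices
`G k = f_k ⊕ g_k` (`f_k, g_k ≥ 0`) satisfies the additive coupling condition, then so does `H` alone. -/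
theorem addSolves_remove_additive {ι κ : Type} [Fintype ι] [Fintype κ] {H : ι → Fin t → Fin t → ℝ}
    (hH : ∀ i a d, 0 ≤ H i a d) {G : κ → Fin t → Fin t → ℝ}
    (hG : ∀ k, ∃ f g : Fin t → ℝ, (∀ a, 0 ≤ f a) ∧ (∀ d, 0 ≤ g d) ∧ ∀ a d, G k a d = f a + g d)
    (h : AddSolves (Sum.elim H G : ι ⊕ κ → Fin t → Fin t → ℝ)) : AddSolves H := by
  choose f g hf hg hfg using hG
  apply addSolves_of_core hH
  intro P S hP1 hP0 hS1 hS0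
  obtain ⟨c₀, c₁, α, β, hc₀, hc₁, hadd, _, _, _, _, hB, hC⟩ := h P S hP1 hP0 hS1 hS0
  -- the additive atoms' own row / column parts under the two coefficient vectors
  set F₀ : Fin t → ℝ := fun a => ∑ k, c₀ (Sum.inr k) * f k a with hF₀
  set G₀ : Fin t → ℝ := fun d => ∑ k, c₀ (Sum.inr k) * g k d with hG₀
  set F₁ : Fin t → ℝ := fun a => ∑ k, c₁ (Sum.inr k) * f k a with hF₁
  set G₁ : Fin t → ℝ := fun d => ∑ k, c₁ (Sum.inr k) * g k d with hG₁
  have hF₀0 : ∀ a, 0 ≤ F₀ a := fun a => Finset.sum_nonneg fun k _ => mul_nonneg (hc₀ _) (hf k a)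
  have hG₀0 : ∀ d, 0 ≤ G₀ d := fun d => Finset.sum_nonneg fun k _ => mul_nonneg (hc₀ _) (hg k d)
  have hF₁0 : ∀ a, 0 ≤ F₁ a := fun a => Finset.sum_nonneg fun k _ => mul_nonneg (hc₁ _) (hf k a)
  have hG₁0 : ∀ d, 0 ≤ G₁ d := fun d => Finset.sum_nonneg fun k _ => mul_nonneg (hc₁ _) (hg k d)
  -- splitting the sums over `ι ⊕ κ`
  have split0 : ∀ a d, ∑ i, c₀ i * Sum.elim H G i a d = ∑ i, c₀ (Sum.inl i) * H i a d + (F₀ a + G₀ d) := by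
    intro a d
    rw [Fintype.sum_sum_type]
    simp only [Sum.elim_inl, Sum.elim_inr, hfg, mul_add, Finset.sum_add_distrib, hF₀, hG₀]
  have split1 : ∀ a d, ∑ i, c₁ i * Sum.elim H G i a d = ∑ i, c₁ (Sum.inl i) * H i a d + (F₁ a + G₁ d) := by
    intro a d
    rw [Fintype.sum_sum_type]
    simp only [Sum.elim_inl, Sum.elim_inr, hfg, mul_add, Finset.sum_add_distrib, hF₁, hG₁]
  refine ⟨fun i => c₀ (Sum.inl i), fun i => c₁ (Sum.inl i), fun a => α a - F₀ a + F₁ a, fun d => β d - G₀ d + G₁ d,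
    fun i => hc₀ _, fun i => hc₁ _, ?_, ?_, ?_⟩
  · intro a d
    have e := hadd a d
    rw [split0, split1] at e
    linarith
  · intro a d ha hd
    have e := hB a d ha hd
    rw [split0] at e
    have := hG₀0 d; have := hF₁0 a
    linarith
  · intro a d ha hd
    have e := hC a d ha hd
    rw [split0] at e
    have := hF₀0 a; have := hG₁0 d
    linarith

/-- Registered form (crux stmt-PneNP-10680, sub-goal `triangle_planeLocal_lines`): additive (line-like) atoms can be dropped from any
dictionary satisfying the additive coupling condition. -/
theorem triangle_planeLocal_lines : ∀ {t : ℕ} {ι κ : Type} [Fintype ι] [Fintype κ] {H : ι → Fin t → Fin t → ℝ} {G : κ → Fin t → Fin t → ℝ}, (∀ i a d, 0 ≤ H i a d) → (∀ k, ∃ f g : Fin t → ℝ, (∀ a, 0 ≤ f a) ∧ (∀ d, 0 ≤ g d) ∧ ∀ a d, G k a d = f a + g d) → AddSolves (Sum.elim H G : ι ⊕ κ → Fin t → Fin t → ℝ) → AddSolves H :=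
  fun hH hG h => addSolves_remove_additive hH hG h

end

end Summit.PneNP.PneNP.Theorems.XorDoor.TriLine
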